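import Summits.Ventures.Crystal3D.Theorems.StickyWulffConstantCoaxialWallLawSeamJunkCapTable
import Summits.Ventures.Crystal3D.Theorems.StickyWulffConstantCoaxialWallLawHealCapHexagon
import Summits.Ventures.Crystal3D.Theorems.StickyWulffConstantCoaxialWallLawHealCapTenHcp
import HarnessLib

/-!
# The junk cap table, second cut: rows «hexagon only ⇒ 4» and «TEN′ (nine + one hcp capper) ⇒ 1» in `JunkCapBound` form, and `capTable₁`
# (crux `CoaxialWallLaw`, stmt-Ventures-19481; line `WallLedgerF`, skeleton 'CoaxialWallLawCertificates' v8.1, input `JunkCapBound` of `…SeamIncoherentAssembly`)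

HONEST FRAMING. Venture `Summits/Ventures/Crystal3D` (cell `crystal3d-full`); two more cap-table rows in the `JunkCapBound` form the assembly
`TailResidue.incoherentSeamSmall_of_assembly` consumes, wrapped from 19481-p1's packing-form rows (`…HealCapHexagon.card_offTip_contacts_le_four_of_hexagon`,
`…HealCapTenHcp.card_offTip_contacts_le_one_of_ten'`), and the lowered table `capTable₁ := capTable₀ ⊓ hexagonCap ⊓ tenHcpCap` with **`junkCapBound_capTable₁`**
(`…SeamJunkCapTable.junkCapBound_min`).  Nothing about the stubs is claimed; the certificate and sparsity inputs are NOT touched; F-C1 not moved.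
THE WRAPPING MECHANISM (as in `…SeamJunkCapRows`): a junk ball (outside the canonical core `coreOf X z S`) caps NO unit triangle of the core (closure maximality
`…SeamCapClosure.mem_capClosure_of_capsTriangleIn`); every tip position the packing-form rows exclude caps a core HEXAGON triangle of the pattern:
* `healTip_triangle_hex` (the six tips vs adjacent HEXAGON pairs, `a, b ∈ hexSix`), `capsTriangleIn_of_tip_hex` (hexagon in the core ⇒ `y + L t` caps a core triangle),
  `hexSix_neg` (the hexagon is centrally symmetric ⇒ the inverted frame `L ∘ (−1)` has the same hexagon, so the LOWER tips `y − L t` cap core triangles too);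
* **`junk_contacts_le_four_of_hexagon`** (row «hexagon only ⇒ ≤ 4»), **`junk_contacts_le_one_of_tenHcp`** (row «nine + hcp capper `basalMirror (slotSite 1)` ⇒ ≤ 1»);
* patterns `HexagonPat`, `TenHcpPat`, rows `hexagonCap := patternCap HexagonPat 4`, `tenHcpCap := patternCap TenHcpPat 1`, instances `junkCapBound_hexagonCap`,
  `junkCapBound_tenHcpCap`; **`capTable₁`**, **`junkCapBound_capTable₁`**, read-off lemmas `capTable₁_le_capTable₀`, `capTable₁_le_four_of_hexagon`, `capTable₁_le_one_of_tenHcp`.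
NOT HERE: the row «hexagon − 1 + lower triple ⇒ 3» ('…HealCapHexFive', separate file, wraps the same way into `capTable₂` once its module is in the tree); the `{100}`
square row is `4 = #empty` in `JunkCapBound` form (the four square sites are neither cappers nor placement sites in general), i.e. already covered by the kissing row.
-/

noncomputable section

namespace Summit.Ventures.Crystal3D.Theorems

namespace TailResidue

open Summit.Ventures.Crystal3D Finset NearIdentity
open Literature.MathematicalPhysics.StatisticalMechanics (basalMirror)
open scoped InnerProductSpace

/-! ### Every tip caps a hexagon triangle -/

/-- Cubic coordinates of the slots (`c = √2/2`). -/
private theorem cc_slot₂ (k : Fin 12) (i : Fin 3) : cubicCoords (slotSite k) i = (slotInt k i : ℝ) / Real.sqrt 2 := by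
  rw [cubicCoords_slotSite]; rfl

/-- Cubic coordinates of the basal mirror of a slot. -/
private theorem cc_mirror₂ (k : Fin 12) :
    cubicCoords (basalMirror (slotSite k)) =
      ![((slotInt k 0 : ℝ) + 2 * slotInt k 1 + 2 * slotInt k 2) / 3 / Real.sqrt 2,
        (2 * (slotInt k 0 : ℝ) + slotInt k 1 - 2 * slotInt k 2) / 3 / Real.sqrt 2,
        (2 * (slotInt k 0 : ℝ) - 2 * slotInt k 1 + slotInt k 2) / 3 / Real.sqrt 2] := by
  rw [cubicCoords_basalMirror]
  ext i; fin_cases i <;> simp [cc_slot₂] <;> ring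

/-- **Every tip caps a HEXAGON triangle**: for each of the six tips `t` there are two adjacent HEXAGON slots `a, b ∈ hexSix` with `t` at distance `1` from both (the
pairs of `…SeamJunkCapRows.healTip_triangle`, recorded inside the hexagon). -/
theorem healTip_triangle_hex {t : EuclideanSpace ℝ (Fin 3)} (ht : t ∈ healTips) :
    ∃ a ∈ hexSix, ∃ b ∈ hexSix, dist (slotSite a) (slotSite b) = 1 ∧ dist t (slotSite a) = 1 ∧ dist t (slotSite b) = 1 := by
  have h2 : Real.sqrt 2 ^ 2 = 2 := Real.sq_sqrt (by norm_num)
  have hs : Real.sqrt 2 ≠ 0 := by positivity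
  simp only [healTips, mem_insert, mem_singleton] at ht
  rcases ht with rfl | rfl | rfl | rfl | rfl | rfl
  · exact ⟨9, by decide, 7, by decide, dist_slotSite_slotSite_eq_one (by decide), dist_slotSite_slotSite_eq_one (by decide),
      dist_slotSite_slotSite_eq_one (by decide)⟩
  · exact ⟨3, by decide, 10, by decide, dist_slotSite_slotSite_eq_one (by decide), dist_slotSite_slotSite_eq_one (by decide),
      dist_slotSite_slotSite_eq_one (by decide)⟩
  · exact ⟨0, by decide, 4, by decide, dist_slotSite_slotSite_eq_one (by decide), dist_slotSite_slotSite_eq_one (by decide),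
      dist_slotSite_slotSite_eq_one (by decide)⟩
  · refine ⟨4, by decide, 10, by decide, dist_slotSite_slotSite_eq_one (by decide), ?_, ?_⟩ <;>
      apply dist_eq_one_of_cubicCoords <;> simp only [cc_mirror₂, cc_slot₂, slotInt, Matrix.cons_val_zero, Matrix.cons_val_one, Matrix.cons_val] <;>
      norm_num <;> field_simp <;> nlinarith [h2]
  · refine ⟨0, by decide, 9, by decide, dist_slotSite_slotSite_eq_one (by decide), ?_, ?_⟩ <;>
      apply dist_eq_one_of_cubicCoords <;> simp only [cc_mirror₂, cc_slot₂, slotInt, Matrix.cons_val_zero, Matrix.cons_val_one, Matrix.cons_val] <;>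
      norm_num <;> field_simp <;> nlinarith [h2]
  · refine ⟨3, by decide, 7, by decide, dist_slotSite_slotSite_eq_one (by decide), ?_, ?_⟩ <;>
      apply dist_eq_one_of_cubicCoords <;> simp only [cc_mirror₂, cc_slot₂, slotInt, Matrix.cons_val_zero, Matrix.cons_val_one, Matrix.cons_val] <;>
      norm_num <;> field_simp <;> nlinarith [h2]

/-- A ball at a tip of a core ball whose HEXAGON lies in the core caps a core triangle. -/
theorem capsTriangleIn_of_tip_hex {D : Finset (EuclideanSpace ℝ (Fin 3))} (L : EuclideanSpace ℝ (Fin 3) ≃ₗᵢ[ℝ] EuclideanSpace ℝ (Fin 3))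
    {y : EuclideanSpace ℝ (Fin 3)} (hy : y ∈ D) (hocc : ∀ k ∈ hexSix, y + L (slotSite k) ∈ D) {t : EuclideanSpace ℝ (Fin 3)} (ht : t ∈ healTips) :
    CapsTriangleIn D (y + L t) := by
  obtain ⟨a, ha, b, hb, hab, hta, htb⟩ := healTip_triangle_hex ht
  refine ⟨y, hy, y + L (slotSite a), hocc a ha, y + L (slotSite b), hocc b hb, dist_slotSite_eq_one L y (slotSite_mem a),
    dist_slotSite_eq_one L y (slotSite_mem b), ?_, ?_, ?_, ?_⟩
  · rw [dist_eq_norm, add_sub_add_left_eq_sub, ← map_sub, LinearIsometryEquiv.norm_map, ← dist_eq_norm, hab]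
  · rw [dist_comm]
    have hn : ‖t‖ = 1 := by
      simp only [healTips, mem_insert, mem_singleton] at ht
      rcases ht with rfl | rfl | rfl | rfl | rfl | rfl <;>
        first
        | exact norm_eq_one_of_mem_fccSlots (slotSite_mem _)
        | (rw [LinearIsometryEquiv.norm_map]; exact norm_eq_one_of_mem_fccSlots (slotSite_mem _))
    rw [dist_eq_norm, show y - (y + L t) = -(L t) by abel, norm_neg, LinearIsometryEquiv.norm_map, hn]
  · rw [dist_eq_norm, add_sub_add_left_eq_sub, ← map_sub, LinearIsometryEquiv.norm_map, ← dist_eq_norm, hta]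
  · rw [dist_eq_norm, add_sub_add_left_eq_sub, ← map_sub, LinearIsometryEquiv.norm_map, ← dist_eq_norm, htb]

/-- **The hexagon is centrally symmetric**: `−slotSite k` is a hexagon slot for every hexagon slot `k` (`0 ↔ 3`, `4 ↔ 7`, `9 ↔ 10`). -/
theorem hexSix_neg : ∀ k ∈ hexSix, ∃ k' ∈ hexSix, slotSite k' = -slotSite k := by
  have key : ∀ k k' : Fin 12, slotInt k' = -slotInt k → slotSite k' = -slotSite k := by
    intro k k' h
    apply cubicCoords_injective
    rw [show -slotSite k = (-1 : ℝ) • slotSite k by simp, cubicCoords_smul, cubicCoords_slotSite, cubicCoords_slotSite]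
    ext i
    simp only [slotVec, h, Pi.neg_apply, Int.cast_neg, Pi.smul_apply, smul_eq_mul]
    ring
  intro k hk
  simp only [hexSix, mem_insert, mem_singleton] at hk
  rcases hk with rfl | rfl | rfl | rfl | rfl | rfl
  · exact ⟨3, by decide, key 0 3 (by decide)⟩
  · exact ⟨0, by decide, key 3 0 (by decide)⟩
  · exact ⟨7, by decide, key 4 7 (by decide)⟩
  · exact ⟨4, by decide, key 7 4 (by decide)⟩
  · exact ⟨10, by decide, key 9 10 (by decide)⟩
  · exact ⟨9, by decide, key 10 9 (by decide)⟩

/-! ### Row «hexagon only ⇒ ≤ 4» -/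

open scoped Classical in
/-- **ROW «hexagon only ⇒ ≤ 4»**: a core ball `y` within `2` of the payer whose six basal hexagon positions of a frame `L` are CORE balls is touched by at most
four balls outside the core. -/
theorem junk_contacts_le_four_of_hexagon {X : Finset (EuclideanSpace ℝ (Fin 3))} (hX : ∀ p ∈ X, ∀ q ∈ X, p ≠ q → 1 ≤ dist p q)
    {z : EuclideanSpace ℝ (Fin 3)} (S : EuclideanSpace ℝ (Fin 3) ≃ₗᵢ[ℝ] EuclideanSpace ℝ (Fin 3)) {y : EuclideanSpace ℝ (Fin 3)}
    (hy : y ∈ coreOf X z S) (hzy : dist z y ≤ 2) (L : EuclideanSpace ℝ (Fin 3) ≃ₗᵢ[ℝ] EuclideanSpace ℝ (Fin 3))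
    (hocc : ∀ k ∈ hexSix, y + L (slotSite k) ∈ coreOf X z S) :
    ((X \ coreOf X z S).filter fun x => dist y x = 1).card ≤ 4 := by
  set D := coreOf X z S with hD
  have hDX : D ⊆ X := coreOf_subset X z S
  -- the inverted frame has the same hexagon
  set L' : EuclideanSpace ℝ (Fin 3) ≃ₗᵢ[ℝ] EuclideanSpace ℝ (Fin 3) := (LinearIsometryEquiv.neg ℝ).trans L with hL'
  have hL'app : ∀ v, L' v = L (-v) := fun v => rfl
  have hocc' : ∀ k ∈ hexSix, y + L' (slotSite k) ∈ D := by
    intro k hk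
    obtain ⟨k', hk', hkk'⟩ := hexSix_neg k hk
    rw [hL'app, ← hkk']
    exact hocc k' hk'
  refine le_trans (card_le_card fun x hx => ?_) (card_offTip_contacts_le_four_of_hexagon hX L (y := y) fun k hk => hDX (hocc k hk))
  obtain ⟨hxXD, hyx⟩ := mem_filter.1 hx
  obtain ⟨hxX, hxD⟩ := mem_sdiff.1 hxXD
  have hxW : x ∈ X.filter fun x => dist z x ≤ 3 := mem_filter.2 ⟨hxX, by linarith [dist_triangle z y x]⟩
  refine mem_filter.2 ⟨hxX, hyx, fun k hk h => hxD (h ▸ hocc k hk), fun ht => hxD ?_, fun ht => hxD ?_⟩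
  · have hcap : CapsTriangleIn D x := by
      have := capsTriangleIn_of_tip_hex L hy hocc ht
      rwa [LinearIsometryEquiv.apply_symm_apply, add_sub_cancel] at this
    exact mem_capClosure_of_capsTriangleIn (siteBallsAt_subset _ _ _) hxW hcap
  · have hcap : CapsTriangleIn D x := by
      have := capsTriangleIn_of_tip_hex L' hy hocc' ht
      rwa [hL'app, neg_neg, LinearIsometryEquiv.apply_symm_apply, add_sub_cancel] at this
    exact mem_capClosure_of_capsTriangleIn (siteBallsAt_subset _ _ _) hxW hcap

/-! ### Row «TEN′ ⇒ ≤ 1» -/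

open scoped Classical in
/-- **ROW «TEN′ ⇒ ≤ 1»**: a core ball `y` within `2` of the payer whose nine closed-lower-half positions of a frame `L` AND the hcp capper
`y + L (basalMirror (slotSite 1))` are CORE balls (a twin-step ball) is touched by at most one ball outside the core. -/
theorem junk_contacts_le_one_of_tenHcp {X : Finset (EuclideanSpace ℝ (Fin 3))} (hX : ∀ p ∈ X, ∀ q ∈ X, p ≠ q → 1 ≤ dist p q)
    {z : EuclideanSpace ℝ (Fin 3)} (S : EuclideanSpace ℝ (Fin 3) ≃ₗᵢ[ℝ] EuclideanSpace ℝ (Fin 3)) {y : EuclideanSpace ℝ (Fin 3)}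
    (hy : y ∈ coreOf X z S) (hzy : dist z y ≤ 2) (L : EuclideanSpace ℝ (Fin 3) ≃ₗᵢ[ℝ] EuclideanSpace ℝ (Fin 3))
    (hocc : ∀ k ∈ lowerNine, y + L (slotSite k) ∈ coreOf X z S) (hocct : y + L (basalMirror (slotSite 1)) ∈ coreOf X z S) :
    ((X \ coreOf X z S).filter fun x => dist y x = 1).card ≤ 1 := by
  set D := coreOf X z S with hD
  have hDX : D ⊆ X := coreOf_subset X z S
  refine le_trans (card_le_card fun x hx => ?_) (card_offTip_contacts_le_one_of_ten' hX L (y := y) (fun k hk => hDX (hocc k hk)) (hDX hocct))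
  obtain ⟨hxXD, hyx⟩ := mem_filter.1 hx
  obtain ⟨hxX, hxD⟩ := mem_sdiff.1 hxXD
  have hxW : x ∈ X.filter fun x => dist z x ≤ 3 := mem_filter.2 ⟨hxX, by linarith [dist_triangle z y x]⟩
  have tipcase : ∀ t ∈ healTips, x = y + L t → False := fun t ht h =>
    hxD (mem_capClosure_of_capsTriangleIn (siteBallsAt_subset _ _ _) hxW (h ▸ capsTriangleIn_of_tip L hy hocc ht))
  exact mem_filter.2 ⟨hxX, hyx, fun k hk h => hxD (h ▸ hocc k hk), fun h => hxD (h ▸ hocct),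
    fun h => tipcase _ (by simp [healTips]) h, fun h => tipcase _ (by simp [healTips]) h⟩

/-! ### Patterns, rows, and the second table -/

/-- Pattern «hexagon only»: the six basal hexagon positions `y + L(slot)`, `slot ∈ hexSix`, are core balls. -/
def HexagonPat (L : EuclideanSpace ℝ (Fin 3) ≃ₗᵢ[ℝ] EuclideanSpace ℝ (Fin 3)) (D : Finset (EuclideanSpace ℝ (Fin 3))) (y : EuclideanSpace ℝ (Fin 3)) : Prop :=
  ∀ k ∈ hexSix, y + L (slotSite k) ∈ D

/-- Pattern «TEN′»: the closed lower half-dozen and the hcp capper `basalMirror (slotSite 1)` are core balls. -/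
def TenHcpPat (L : EuclideanSpace ℝ (Fin 3) ≃ₗᵢ[ℝ] EuclideanSpace ℝ (Fin 3)) (D : Finset (EuclideanSpace ℝ (Fin 3))) (y : EuclideanSpace ℝ (Fin 3)) : Prop :=
  (∀ k ∈ lowerNine, y + L (slotSite k) ∈ D) ∧ y + L (basalMirror (slotSite 1)) ∈ D

/-- Row «hexagon only ⇒ `4`». -/
def hexagonCap : Finset (EuclideanSpace ℝ (Fin 3)) → EuclideanSpace ℝ (Fin 3) → ℕ := patternCap HexagonPat 4

/-- Row «TEN′ ⇒ `1`». -/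
def tenHcpCap : Finset (EuclideanSpace ℝ (Fin 3)) → EuclideanSpace ℝ (Fin 3) → ℕ := patternCap TenHcpPat 1

/-- The hexagon-only row is a junk cap bound. -/
theorem junkCapBound_hexagonCap : JunkCapBound hexagonCap :=
  junkCapBound_patternCap fun _ hX _ _ S _ hy hzy L hL => junk_contacts_le_four_of_hexagon hX S hy hzy L hL

/-- The TEN′ row is a junk cap bound. -/
theorem junkCapBound_tenHcpCap : JunkCapBound tenHcpCap :=
  junkCapBound_patternCap fun _ hX _ _ S _ hy hzy L hL => junk_contacts_le_one_of_tenHcp hX S hy hzy L hL.1 hL.2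

/-- **THE SECOND CAP TABLE**: `capTable₀ ⊓ hexagonCap ⊓ tenHcpCap`. -/
def capTable₁ (D : Finset (EuclideanSpace ℝ (Fin 3))) (y : EuclideanSpace ℝ (Fin 3)) : ℕ :=
  min (min (capTable₀ D y) (hexagonCap D y)) (tenHcpCap D y)

/-- **`JunkCapBound capTable₁`.** -/
theorem junkCapBound_capTable₁ : JunkCapBound capTable₁ :=
  junkCapBound_min (junkCapBound_min junkCapBound_capTable₀ junkCapBound_hexagonCap) junkCapBound_tenHcpCap

/-- The second table lowers the first. -/
theorem capTable₁_le_capTable₀ (D : Finset (EuclideanSpace ℝ (Fin 3))) (y : EuclideanSpace ℝ (Fin 3)) : capTable₁ D y ≤ capTable₀ D y :=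
  (min_le_left _ _).trans (min_le_left _ _)

/-- Reading the table, hexagon-only row. -/
theorem capTable₁_le_four_of_hexagon {D : Finset (EuclideanSpace ℝ (Fin 3))} {y : EuclideanSpace ℝ (Fin 3)} (L : EuclideanSpace ℝ (Fin 3) ≃ₗᵢ[ℝ] EuclideanSpace ℝ (Fin 3))
    (h : ∀ k ∈ hexSix, y + L (slotSite k) ∈ D) : capTable₁ D y ≤ 4 :=
  (min_le_left _ _).trans ((min_le_right _ _).trans (patternCap_le_of_pat (pat := HexagonPat) L h))

/-- Reading the table, TEN′ row. -/
theorem capTable₁_le_one_of_tenHcp {D : Finset (EuclideanSpace ℝ (Fin 3))} {y : EuclideanSpace ℝ (Fin 3)} (L : EuclideanSpace ℝ (Fin 3) ≃ₗᵢ[ℝ] EuclideanSpace ℝ (Fin 3))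
    (h : ∀ k ∈ lowerNine, y + L (slotSite k) ∈ D) (ht : y + L (basalMirror (slotSite 1)) ∈ D) : capTable₁ D y ≤ 1 :=
  (min_le_right _ _).trans (patternCap_le_of_pat (pat := TenHcpPat) L ⟨h, ht⟩)

/-- **The assembly with the junk-cap input discharged, second table**: any cap function dominating `capTable₁` pointwise will do for the certificate. -/
theorem incoherentSeamSmall_of_cert_of_sparsity₁ {cap : Finset (EuclideanSpace ℝ (Fin 3)) → EuclideanSpace ℝ (Fin 3) → ℕ} (hle : ∀ D y, capTable₁ D y ≤ cap D y)
    {s s₁ p₀ : ℝ} {n₀ k₀ : ℕ} (hcert : CoherentCoreCap cap s₁) (hsp : SeamSparsity p₀ n₀ k₀) (hp₀ : 0 < p₀) (hs : s₁ + n₀ / p₀ ≤ s) :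
    IncoherentSeamSmall s k₀ :=
  incoherentSeamSmall_of_assembly cap hcert (junkCapBound_mono junkCapBound_capTable₁ hle) hsp hp₀ hs

end TailResidue

end Summit.Ventures.Crystal3D.Theorems

end
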